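import Literature.IUT.LogThetaLattice.LGPMonoidSignatureNonVacuity
import Literature.AnabelianGeometry.AbsoluteAnabelian.LogShellsOfUnitLog
import HarnessLib

/-!
# [IUTchIII] Prop 3.4 (ii): `LGPMonoidSignature` inhabited with `𝓘^ℚ` := THE TYPED `ℚ_p`-SPAN OF THE PACKET
# LOG-SHELL (non-vacuity sequel; NV-L6 row «LGPMonoidSignature», 𝓘^ℚ-strengthening)

S. Mochizuki, *Inter-universal Teichmüller theory III*, kurims manuscript (May 2020), §3, Prop. 3.4 (ii) p. 103
(the two properties "is a subset of `𝓘^ℚ(^{S^±_{j+1},j;‡}𝓕_v)`", "acts multiplicatively on `𝓘^ℚ(…)`"), Prop. 3.2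
(ii) p. 99 (`𝓘^ℚ(−)` := "the `ℚ`-span of `𝓘(−)`") [claim: Mochizuki2012, status: disputed] (IUTchIII §3 Prop 3.4
(ii), kurims p.103). Record-only vocabulary (claim key `Mochizuki2012`, D-0012, disputed); abc-iut cell, layer L6.

PROOF-ONLY SEQUEL (seat abc-iut-w5-d086; second-reader INFO N1 on abc-iut-w5-d112's `LGPMonoidSignatureNonVacuity`,
STATUS 2026-08-26T03:39Z, offered 03:5xZ) to abc-iut-w5-d112's witness `LGPMonoidSignature.nonempty_model`
(p-id of `LGPMonoidSignatureNonVacuity.lean`). There the signature's parameter `𝓘^ℚ` is instantiated at `⊤`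
("JUSTIFICATION … at a bad place the `ℚ_p`-span of the packet log-shell IS the whole packet — abc-iut-w4-d036's
`shellQSpan_shellPacketAt_eq_top`"), so the two printed properties are discharged by `simp`/`mem_top`. HERE the
parameter is instantiated at the TYPED object itself — abc-iut-L6-t4's `shellQSpan ℚ_[p] (shellPacketAt ℚ_[p] …)`
([IUTchIII] Prop. 3.2 (ii): the `ℚ_p`-span of the packet log-shell `𝓘(^{S^±_{j+1},j}𝒟^⊢_v)` generated by the local
log-shells `ℐ = closure (logShell Lg)` of [AbsTopIII] Def. 5.4 (iii), abc-iut-L4-t3), regarded as a `ℚ`-submodule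
by restriction of scalars — and the witness is TRANSPORTED along the kernel equality `𝓘^ℚ = ⊤`
(`shellQSpan_shellPacketAt_eq_top`, p412324), so that the two printed properties now refer to the typed `𝓘^ℚ`:

* `LGPMonoidSignature.iQShell_eq_top` — at the one-bad-place tensor-packet model the typed `𝓘^ℚ` of every label
  `j` is the whole packet (w4-d036's theorem, specialised; `restrictScalars` bookkeeping);
* `LGPMonoidSignature.nonempty_model_shellQSpan` — the signature with `𝓘^ℚ := ` the typed span is INHABITED by
  w5-d112's genuine-carrier witness (same monoids `Ψ = ι(𝒪^×·q^{j²ℕ})`, `Ψ^⊥ = ι(μ_{2l}·q^{j²ℕ})`);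
* `LGPMonoidSignature.nonempty_model_shellQSpan_padic` — the concrete instantiation `K := ℚ_p`, local log-shell
  from abc-iut-L4's `PadicLogOnUnits.ofUnitLog p ℚ_p` (the genuine `p`-adic logarithm), `q := p` (so
  `0 < ‖q‖ < 1`: a non-unit, non-zero parameter, as print's `q̲_v`).

HONEST LABEL: unchanged from the parent witness — GENUINE carrier/monoids, SIMPLIFIED in «one place, equal factors,
`_∞Ψ := Ψ`»; the only upgrade is «`𝓘^ℚ` = the typed `ℚ_p`-span of the packet log-shell» instead of «`𝓘^ℚ := ⊤`».
No `def`, no instance, no named fact; nothing here bears on [IUTchIII] Cor. 3.12; witnessed ≠ endorsed.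
-/

noncomputable section

namespace Literature.IUT.LogThetaLattice

open Literature.IUT.HodgeArakelov Literature.AnabelianGeometry.AbsoluteAnabelian

/-- At the one-bad-place tensor-packet model (all factors `K`, `𝕍 = {v}`), the TYPED `𝓘^ℚ` of the label `j = i+1`
— the `ℚ_p`-span of the packet log-shell generated by the local log-shells `closure (logShell Lg)` — is the whole
`(S^±_{j+1}, j)`-packet (abc-iut-w4-d036's `shellQSpan_shellPacketAt_eq_top`, p412324), also after restriction of
scalars to `ℚ`. [claim: Mochizuki2012, status: disputed] (IUTchIII §3 Prop 3.2 (ii), kurims p.99) -/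
theorem LGPMonoidSignature.iQShell_eq_top (p : ℕ) [Fact p.Prime] (K : Type) [NontriviallyNormedField K]
    [Algebra ℚ_[p] K] [IsBoundedSMul ℚ_[p] K] [IsUltrametricDist K] [CharZero K] (Lg : PadicLogOnUnits K)
    (lstar : ℕ) (i : Fin lstar) :
    (shellQSpan ℚ_[p]
        (shellPacketAt ℚ_[p] (fun (_ : Fin ((i : ℕ) + 1 + 1)) (_ : Unit) => K)
          (fun _ _ => AddSubgroup.closure (logShell Lg)) (Fin.last ((i : ℕ) + 1)) ())).restrictScalars ℚ =
      (⊤ : Submodule ℚ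
        (PacketAt ℚ_[p] (fun (_ : Fin ((i : ℕ) + 1 + 1)) (_ : Unit) => K) (Fin.last ((i : ℕ) + 1)) ())) := by
  rw [Submodule.restrictScalars_eq_top_iff]
  exact shellQSpan_shellPacketAt_eq_top p (fun (_ : Fin ((i : ℕ) + 1 + 1)) (_ : Unit) => K)
    (fun _ _ => Lg) (Fin.last ((i : ℕ) + 1)) ()

/-- **`LGPMonoidSignature` is inhabited with `𝓘^ℚ` := the TYPED `ℚ_p`-span of the packet log-shell** (restricted to
`ℚ`), at abc-iut-w5-d112's genuine one-bad-place tensor-packet model (`Ψ = ι(𝒪^× · q^{j²ℕ})`,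
`Ψ^⊥ = ι(μ_{2l} · q^{j²ℕ})`): transport of `LGPMonoidSignature.nonempty_model` along `iQShell_eq_top`, so that the two
printed properties of Prop. 3.4 (ii) p. 103 ("is a subset of `𝓘^ℚ(…)`", "acts multiplicatively on `𝓘^ℚ(…)`") are
stated — and hold — for the typed `𝓘^ℚ`. [claim: Mochizuki2012, status: disputed] (IUTchIII §3 Prop 3.4 (ii),
kurims p.103) -/
theorem LGPMonoidSignature.nonempty_model_shellQSpan (p : ℕ) [Fact p.Prime] (K : Type) [NontriviallyNormedField K]
    [Algebra ℚ_[p] K] [IsBoundedSMul ℚ_[p] K] [IsUltrametricDist K] [CharZero K] (Lg : PadicLogOnUnits K)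
    (lstar twoL : ℕ) (htwoL : 0 < twoL) (q : K) :
    Nonempty (LGPMonoidSignature lstar Unit (fun _ => True)
      (fun (_ : Unit) (i : Fin lstar) =>
        PacketAt ℚ_[p] (fun (_ : Fin ((i : ℕ) + 1 + 1)) (_ : Unit) => K) (Fin.last ((i : ℕ) + 1)) ())
      (fun (_ : Unit) (i : Fin lstar) =>
        (shellQSpan ℚ_[p]
          (shellPacketAt ℚ_[p] (fun (_ : Fin ((i : ℕ) + 1 + 1)) (_ : Unit) => K)
            (fun _ _ => AddSubgroup.closure (logShell Lg)) (Fin.last ((i : ℕ) + 1)) ())).restrictScalars ℚ)) := by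
  have h : (fun (_ : Unit) (i : Fin lstar) =>
      (shellQSpan ℚ_[p]
        (shellPacketAt ℚ_[p] (fun (_ : Fin ((i : ℕ) + 1 + 1)) (_ : Unit) => K)
          (fun _ _ => AddSubgroup.closure (logShell Lg)) (Fin.last ((i : ℕ) + 1)) ())).restrictScalars ℚ) =
      fun (_ : Unit) (i : Fin lstar) =>
        (⊤ : Submodule ℚ
          (PacketAt ℚ_[p] (fun (_ : Fin ((i : ℕ) + 1 + 1)) (_ : Unit) => K) (Fin.last ((i : ℕ) + 1)) ())) := by
    funext _ i
    exact LGPMonoidSignature.iQShell_eq_top p K Lg lstar i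
  rw [h]
  exact LGPMonoidSignature.nonempty_model p K lstar twoL htwoL q

/-- **Concrete instantiation**: `K := ℚ_p` with the genuine `p`-adic logarithm on units
(`PadicLogOnUnits.ofUnitLog p ℚ_p`, abc-iut-L4), `l⋆ = 2`, `2l = 2`, `q := p` (`0 < ‖p‖_p = p⁻¹ < 1`).
[claim: Mochizuki2012, status: disputed] (IUTchIII §3 Prop 3.4 (ii), kurims p.103) -/
theorem LGPMonoidSignature.nonempty_model_shellQSpan_padic (p : ℕ) [Fact p.Prime] :
    Nonempty (LGPMonoidSignature 2 Unit (fun _ => True)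
      (fun (_ : Unit) (i : Fin 2) =>
        PacketAt ℚ_[p] (fun (_ : Fin ((i : ℕ) + 1 + 1)) (_ : Unit) => ℚ_[p]) (Fin.last ((i : ℕ) + 1)) ())
      (fun (_ : Unit) (i : Fin 2) =>
        (shellQSpan ℚ_[p]
          (shellPacketAt ℚ_[p] (fun (_ : Fin ((i : ℕ) + 1 + 1)) (_ : Unit) => ℚ_[p])
            (fun _ _ => AddSubgroup.closure (logShell (PadicLogOnUnits.ofUnitLog p ℚ_[p])))
            (Fin.last ((i : ℕ) + 1)) ())).restrictScalars ℚ)) ∧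
    0 < ‖(p : ℚ_[p])‖ ∧ ‖(p : ℚ_[p])‖ < 1 :=
  ⟨LGPMonoidSignature.nonempty_model_shellQSpan p ℚ_[p] (PadicLogOnUnits.ofUnitLog p ℚ_[p]) 2 2 two_pos
      (p : ℚ_[p]),
    by rw [Padic.norm_p]; exact inv_pos.mpr (by exact_mod_cast (Fact.out : p.Prime).pos),
    by rw [Padic.norm_p]; exact inv_lt_one_of_one_lt₀ (by exact_mod_cast (Fact.out : p.Prime).one_lt)⟩

end Literature.IUT.LogThetaLattice

end
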